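import Literature.Analysis.FluidPDE.LocalTypeICharacterization
import Literature.Analysis.FluidPDE.LocalTypeIProofs
import Literature.Analysis.FluidPDE.LocalTypeIPersistenceHolds
import HarnessLib

/-!
# Albritton–Barker 2019, Theorem 1.1 — reduction to its forward half

Analysis/FluidPDE glue module over `Literature/Analysis/FluidPDE/LocalTypeI.lean` (D. Albritton,
T. Barker, *On local Type I singularities of the Navier–Stokes equations and Liouville theorems*,
J. Math. Fluid Mech. 21 (2019), no. 3 = arXiv:1811.00502, **Theorem 1.1**: "The following are
equivalent: • There exists a suitable weak solution with Type I singular point. • There exists a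
non-trivial mild bounded ancient solution with `𝐈 < ∞`."; corrected rendering
`Literature.Analysis.FluidPDE.AlbrittonBarkerTypeICharacterization :=
LocalTypeISingularityExists ↔ NontrivialMildAncientTypeIExists`).

The accepted reduction `albrittonBarkerTypeICharacterization_of_tools`
(`LocalTypeICharacterization.lean`) derives Theorem 1.1 from the three printed results its proof
quotes (A–B §3): the forward half `AlbrittonBarkerForward` ("essentially known": Prop. 2.4, the
regular cylinder lemma, and the rescaling procedure of Seregin–Šverák 2009, Thm 2.8), Lemma 2.2
`SuitableCompactness` (compactness of suitable weak solutions, after Lin 1998) and Prop. 2.3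
`PersistenceOfSingularities` (persistence of singularities, after Rusin–Šverák 2011), the reverse
half — "the main novelty" — being the theorem
`localTypeISingularityExists_of_nontrivialMildAncientTypeIExists` (`LocalTypeIReverse.lean`).
Lemma 2.2 and Prop. 2.3 are discharged in tree (`SuitableCompactness_holds`,
`LocalTypeIProofs.lean`; `PersistenceOfSingularities_holds`, `LocalTypeIPersistenceHolds.lean`),
so the trust base of the corrected Theorem 1.1 is now the forward half alone:

* `AlbrittonBarkerTypeICharacterization_of_forward :
    AlbrittonBarkerForward → AlbrittonBarkerTypeICharacterization`.

What is NOT here: the discharge `AlbrittonBarkerTypeICharacterization_holds`. It is the one-line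
composite `AlbrittonBarkerTypeICharacterization_of_forward AlbrittonBarkerForward_holds`, to be
appended to this module once the named fact `AlbrittonBarkerForward`
(`LocalTypeICharacterization.lean`; Seregin–Šverák's blow-up procedure at an earlier singular
point) is discharged — `LocalTypeI.lean` itself cannot host it, since the proofs layer imports
that file.

Theorem-only glue module: no definitions, no named facts, no `sorry`; the theorem is a
composition of an accepted tree reduction with accepted discharges (pure proof over unchanged
statements).

## References

* D. Albritton, T. Barker, *On local Type I singularities of the Navier–Stokes equations and
  Liouville theorems*, J. Math. Fluid Mech. 21 (2019), no. 3, doi:10.1007/s00021-019-0448-z,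
  arXiv:1811.00502: Thm 1.1 (p. 2), Lemma 2.2, Prop. 2.3 (p. 5), Prop. 2.4 (p. 6), §3 (proof of
  Thm 1.1, p. 8). [AlbrittonBarker2019]
* F. Lin, *A new proof of the Caffarelli–Kohn–Nirenberg theorem*, Comm. Pure Appl. Math. 51
  (1998), 241–257, Thm 2.2. [Lin1998]
* W. Rusin, V. Šverák, *Minimal initial data for potential Navier–Stokes singularities*,
  J. Funct. Anal. 260 (2011), 879–891, Lemmas 2.1–2.2.
* G. Seregin, V. Šverák, *On Type I singularities of the local axi-symmetric solutions of the
  Navier–Stokes equations*, Comm. PDE 34 (2009), 171–201, arXiv:0804.1803, Thm 2.8.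
-/

noncomputable section

namespace Literature.Analysis.FluidPDE

/-- **Albritton–Barker 2019, Theorem 1.1, from its forward half.** The corrected rendering
`AlbrittonBarkerTypeICharacterization` (`LocalTypeISingularityExists ↔
NontrivialMildAncientTypeIExists`: "there exists a suitable weak solution with Type I singular
point" iff "there exists a non-trivial mild bounded ancient solution with `𝐈 < ∞`") follows from
the forward implication `AlbrittonBarkerForward` alone (A–B §3: Prop. 2.4 and Seregin–Šverák
2009, Thm 2.8), the reverse implication being proved in tree from Lemma 2.2 and Prop. 2.3, both
of which are discharged (`SuitableCompactness_holds`, `PersistenceOfSingularities_holds`).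
[cite: AlbrittonBarker2019, Thm 1.1] -/
theorem AlbrittonBarkerTypeICharacterization_of_forward (hfwd : AlbrittonBarkerForward) :
    AlbrittonBarkerTypeICharacterization :=
  albrittonBarkerTypeICharacterization_of_tools hfwd SuitableCompactness_holds
    PersistenceOfSingularities_holds

end Literature.Analysis.FluidPDE
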